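import Summits.MatrixMultiplication.MatrixMultiplication.Theorems.CatalyticDegenerationCatalyticTransfer
import Literature.Computability.AlgebraicComplexity.TensorRestrictionRank

/-!
# `CatalyticRate ↔ MatrixMultiplication` — the deciding crux of route CatalyticDegeneration is
provably a restatement of the summit (crux-strategist evidence, stmt-MatrixMultiplication-3634)

`CatalyticRate → MatrixMultiplication` is the route's deciding theorem `closes` fed with the PROVED
support item `CatalyticTransfer` (`Theorems.catalyticTransfer_proof`).  The converse
`MatrixMultiplication → CatalyticRate` is proved here with the EMPTY catalyst: `ω(ℂ) = 2` gives
`R(⟨n,n,n⟩) ≤ A·n^{2+ε}` (`exists_tensorRank_matMulTensor_le_rpow`), a rank bound is a restriction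
from the unit tensor (`tensorRestrictsTo_unitTensor_of_tensorRank_le`), a restriction is a
degeneration, degeneration is compatible with `⊕` (`polyDegeneratesTo_directSum`), and for
`k > log₂ A / ε` the constant is absorbed: `A·(2^k)^{2+ε} ≤ 2^{εk}·2^{(2+ε)k} = 4^{(1+ε)k}`.
Hence `CatalyticRate ↔ ω(ℂ) = 2` is a theorem of the tree (no hypotheses), which is the precise
content of the re-audit verdict RESTATED.  No `sorry`, no new axioms.
-/

noncomputable section

-- the tree's namespace `Summit.MatrixMultiplication.MatrixMultiplication.…` repeats a component by design (D-0017)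
set_option linter.dupNamespace false

namespace Summit.MatrixMultiplication.MatrixMultiplication.Cruxes.CatalyticRate

open Literature.Computability.AlgebraicComplexity
open Literature.Barriers.MatrixMultiplication
open Summit.MatrixMultiplication.MatrixMultiplication.Theses.CatalyticDegeneration
open Summit.MatrixMultiplication.MatrixMultiplication.Theorems

/-- Absorbing a constant into the exponent: if `0 < A`, `0 < ε` and `log₂ A / ε < k` then
`A · (2^k)^{2+ε} ≤ 4^{(1+ε)k}`. [folklore] -/
theorem const_mul_rpow_le_four_rpow {A ε : ℝ} {k : ℕ} (hA : 0 < A) (hε : 0 < ε)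
    (hk : Real.logb 2 A / ε < k) :
    A * (((2 : ℕ) ^ k : ℕ) : ℝ) ^ (2 + ε) ≤ (4 : ℝ) ^ ((1 + ε) * k) := by
  have hlt : Real.logb 2 A < ε * k := by
    rw [div_lt_iff₀ hε] at hk
    linarith [mul_comm (k : ℝ) ε]
  have hA2 : A ≤ (2 : ℝ) ^ (ε * k) := by
    have h := Real.rpow_le_rpow_of_exponent_le (by norm_num : (1 : ℝ) ≤ 2) hlt.le
    rwa [Real.rpow_logb (by norm_num) (by norm_num) hA] at h
  have hn : (((2 : ℕ) ^ k : ℕ) : ℝ) = (2 : ℝ) ^ (k : ℝ) := by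
    push_cast
    exact (Real.rpow_natCast 2 k).symm
  have hpos : (0 : ℝ) ≤ (((2 : ℕ) ^ k : ℕ) : ℝ) ^ (2 + ε) := by positivity
  calc A * (((2 : ℕ) ^ k : ℕ) : ℝ) ^ (2 + ε)
      ≤ (2 : ℝ) ^ (ε * k) * (((2 : ℕ) ^ k : ℕ) : ℝ) ^ (2 + ε) :=
        mul_le_mul_of_nonneg_right hA2 hpos
    _ = (4 : ℝ) ^ ((1 + ε) * k) := by
        rw [hn, ← Real.rpow_mul (by norm_num : (0 : ℝ) ≤ 2), ← Real.rpow_add (by norm_num : (0 : ℝ) < 2),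
          show (4 : ℝ) = (2 : ℝ) ^ (2 : ℝ) by norm_num, ← Real.rpow_mul (by norm_num : (0 : ℝ) ≤ 2)]
        congr 1
        ring

/-- **`ω(ℂ) = 2 → CatalyticRate`** (empty catalyst): the summit implies the deciding crux.
[folklore] -/
theorem catalyticRate_of_matrixMultiplication (hS : _root_.MatrixMultiplication) : CatalyticRate := by
  intro ε hε
  have hω : omega ℂ = 2 := (_root_.MatrixMultiplication_iff).1 hS
  obtain ⟨A, hA, hAb⟩ := exists_tensorRank_matMulTensor_le_rpow ℂ hε
  obtain ⟨k₀, hk₀⟩ := exists_nat_gt (Real.logb 2 A / ε)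
  have hk : Real.logb 2 A / ε < ((k₀ + 1 : ℕ) : ℝ) := hk₀.trans (by push_cast; linarith)
  have hn1 : 1 ≤ 2 ^ (k₀ + 1) := Nat.one_le_two_pow
  refine ⟨k₀ + 1, tensorRank (matMulTensor ℂ (2 ^ (k₀ + 1)) (2 ^ (k₀ + 1)) (2 ^ (k₀ + 1))), 0, 0, 0,
    fun _ _ _ => 0, Nat.succ_le_succ (Nat.zero_le _), ?_, ?_, ?_⟩
  · exact (Nat.one_le_pow _ _ hn1).trans (matMulTensor_sq_le_tensorRank ℂ (2 ^ (k₀ + 1)))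
  · have h1 := hAb (2 ^ (k₀ + 1)) hn1
    rw [hω] at h1
    exact h1.trans (const_mul_rpow_le_four_rpow hA hε hk)
  · exact polyDegeneratesTo_directSum
      (tensorRestrictsTo_unitTensor_of_tensorRank_le _ le_rfl).polyDegeneratesTo
      (polyDegeneratesTo_refl _)

/-- **`CatalyticRate → ω(ℂ) = 2`**: the route's deciding theorem with the proved transfer. [folklore] -/
theorem matrixMultiplication_of_catalyticRate (hR : CatalyticRate) : _root_.MatrixMultiplication :=
  closes catalyticTransfer_proof hR

/-- **The deciding crux is a restatement of the summit**: `CatalyticRate ↔ MatrixMultiplication`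
(i.e. `↔ ω(ℂ) = 2`), unconditionally. [folklore] -/
theorem catalyticRate_iff_matrixMultiplication : CatalyticRate ↔ _root_.MatrixMultiplication :=
  ⟨matrixMultiplication_of_catalyticRate, catalyticRate_of_matrixMultiplication⟩

/-- Axiom audit hook. -/
theorem catalyticRate_iff_omega_eq_two : CatalyticRate ↔ omega ℂ = 2 :=
  catalyticRate_iff_matrixMultiplication.trans _root_.MatrixMultiplication_iff

#print axioms catalyticRate_iff_omega_eq_two

end Summit.MatrixMultiplication.MatrixMultiplication.Cruxes.CatalyticRate

end
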